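import Literature.AlgebraicGeometry.Resolution.AbhyankarToroidalCharts
import Literature.AlgebraicGeometry.Resolution.GeneralizedStability
import Literature.AlgebraicGeometry.Resolution.TranscendentallyImmediate
import Mathlib.GroupTheory.OrderOfElement
import Mathlib.LinearAlgebra.Dimension.Free
import HarnessLib

/-!
# Abhyankar transcendence bases: existence, finite extensions, adapted bases (Temkin 2013, §2.1, §5.5)

Topic: `Literature/AlgebraicGeometry/Resolution`. M. Temkin, *Inseparable local uniformization*,
J. Algebra 373 (2013) 65–119 = arXiv:0804.1554v3 (numbers and pages of this version). The proof
of Thm. 5.5.2 (pp. 60–61) manipulates Abhyankar transcendence bases `B = B_E ⊔ B_F`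
(`IsAbhyankarBasis`, `AbhyankarToroidalCharts.lean`) of a finitely generated Abhyankar valued
field `K` over the trivially valued `k ⊆ K°` in three ways, PROVED here:

* `exists_isAbhyankarBasis` — **existence** (§2.1, p. 10: "for a finite `N` the extension is
  Abhyankar if and only if `D_{l/k} = 0`", i.e. `D = 0` iff there is a transcendence basis
  satisfying condition (*)): `E` elements with `ℤ`-independent values and `F` elements with
  algebraically independent residues (`AbhyankarInvariants.lean`, `PrimeDivisors.lean`) form a
  transcendence basis when `E + F = N` (Knaf–Kuhlmann 2005, Thm. 2.1 =
  `algebraicIndependent_sumElim_of_valuation`); the values generate a subgroup of finite index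
  (Remark 2.1.3) and the residues a transcendence basis of `K̃`.
* `IsAbhyankarBasis.extension` — **finite extensions** (proof of Thm. 5.5.2, p. 61: "Notice
  that `B` is an Abhyankar basis of each `Kᵢ`"): an Abhyankar basis of `K` is one of every finite
  extension `K₁ ⊇ K` of valued fields (`E`, `F`, `N` do not change: `ratRank_comap_le`,
  `residueTrdeg_comap_le`, `D_{K₁/k} = 0`; the value group of `K` has finite index in that of `K₁`).
* `exists_adapted_isAbhyankarBasis` — **adapted bases** (the hypothesis of Thm. 5.5.1 (iii),
  p. 59: "`B̃_F` is a separable transcendence basis of `K̃` and `|B_E|` is a basis of `|K^×|`";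
  proof of Thm. 5.5.2, p. 60: "Find an Abhyankar transcendence basis `B` of `K` as in
  Theorem 5.5.1 (iii)"): given any finite transcendence basis `s` of `K̃/k` (e.g. a separating
  one, Thm. 5.5.3) there is an Abhyankar basis whose `B_F` reduces onto `s` and whose values
  `|B_E|` form a `ℤ`-basis of the lattice `Λ = |K^×|` (Remark 2.1.3,
  `valueGroup_lattice_of_transcendenceDefect_eq_zero`).

## Sources

* M. Temkin, *Inseparable local uniformization*, arXiv:0804.1554v3: §2.1 (pp. 9–10, condition (*),
  Remark 2.1.3), Thm. 5.5.1 (iii) (p. 59), proof of Thm. 5.5.2 (pp. 60–61).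
* H. Knaf, F.-V. Kuhlmann, *Abhyankar places admit local uniformization in any characteristic*,
  Ann. Sci. ÉNS 38 (2005), Thm. 2.1 (valuation independence), as proved in the tree.
-/

noncomputable section

namespace Literature.AlgebraicGeometry.Resolution

open IsLocalRing ValuationSubring Cardinal

universe u

variable {k K : Type u} [Field k] [Field K] [Algebra k K]

/-! ### Bookkeeping: `N`, `E`, `F` as natural numbers -/

section Numbers

variable (O : ValuationSubring K) (hk : ∀ c : k, algebraMap k K c ∈ O)

/-- For a finitely generated `K/k` with `D = 0`: natural numbers `E = ratRank`, `F = residueTrdeg`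
with `E + F = tr.deg`. [folklore] -/
theorem exists_ratRank_eq_residueTrdeg_eq (hfg : (⊤ : IntermediateField k K).FG)
    (hD : transcendenceDefect k O hk = 0) :
    ∃ E F : ℕ, ratRank O = E ∧ residueTrdeg k O hk = F ∧ Algebra.trdeg k K = (E + F : ℕ) := by
  have hN : Algebra.trdeg k K < ℵ₀ := trdeg_lt_aleph0_of_fg hfg
  obtain ⟨N, hNn⟩ := Cardinal.lt_aleph0.mp hN
  obtain ⟨E, hE⟩ := Cardinal.lt_aleph0.mp (ratRank_lt_aleph0 O hk hN)
  obtain ⟨F, hF⟩ := Cardinal.lt_aleph0.mp (residueTrdeg_lt_aleph0 O hk hN)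
  refine ⟨E, F, hE, hF, ?_⟩
  have h := (transcendenceDefect_eq_zero_iff O hk hN).mp hD
  rw [hE, hF, hNn] at h
  rw [hNn]
  exact_mod_cast h.symm

end Numbers

/-! ### Existence of Abhyankar bases -/

section Existence

variable (O : ValuationSubring K) (hk : ∀ c : k, algebraMap k K c ∈ O)

/-- **A finitely generated valued field with `D = 0` has an Abhyankar transcendence basis**
(Temkin 2013, §2.1, p. 10: "If `l/k` admits a transcendence basis `B` that satisfies (*) then we
say that `l/k` is Abhyankar … for a finite `N` the extension is Abhyankar if and only if
`D_{l/k} = 0`"; Remark 2.1.3 for the finite index of `Λ_B` and the residual transcendence basis).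
PROVED. [cite: Temkin2013, Section 2.1 (p. 10) and Remark 2.1.3] -/
theorem exists_isAbhyankarBasis (hfg : (⊤ : IntermediateField k K).FG)
    (hD : transcendenceDefect k O hk = 0) :
    ∃ (E F : ℕ) (x : Fin E → K) (y : Fin F → O), IsAbhyankarBasis O hk x y := by
  classical
  letI := algebraOfMem k O hk
  haveI := isScalarTower_algebraOfMem k O hk
  obtain ⟨E, F, hE, hF, hNEF⟩ := exists_ratRank_eq_residueTrdeg_eq O hk hfg hD
  obtain ⟨y, hy⟩ := exists_algebraicIndependent_residue_of_residueTrdeg_eq O hk F hF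
  obtain ⟨x, hx0, hx⟩ := exists_linearIndependent_valuation_of_ratRank_eq O E hE
  have hBind : AlgebraicIndependent k (Sum.elim x fun i => (y i : K)) :=
    algebraicIndependent_sumElim_of_valuation O y hy x (injective_valuation_prod_pow O x hx0 hx)
  have hcard : Cardinal.lift.{0} (Algebra.trdeg k K) ≤ Cardinal.lift.{u} #(Fin E ⊕ Fin F) := by
    rw [hNEF]
    simp only [Cardinal.mk_sum, Cardinal.mk_fin, Cardinal.lift_natCast, Cardinal.lift_add]
    exact (Nat.cast_add E F).le
  have hB : IsTranscendenceBasis k (Sum.elim x fun i => (y i : K)) :=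
    hBind.isTranscendenceBasis_of_lift_trdeg_le_of_finite hcard
  -- finite index of `Λ_B` (Remark 2.1.3)
  obtain ⟨hfi, -⟩ := valueGroup_fg_of_isTranscendenceBasis O y x hfg hy hx0 hx hB
  -- the residues of `B_F` form a transcendence basis of `K̃`
  have hFfg := (residueField_fg_of_isTranscendenceBasis O y x hfg hy hx0 hx hB).2
  have hyB : IsTranscendenceBasis k fun i => residue O (y i) := by
    refine hy.isTranscendenceBasis_of_lift_trdeg_le_of_finite ?_
    have hFeq : Algebra.trdeg k (ResidueField O) = F := by
      rw [← residueTrdeg_eq (k := k) O hk]; exact hF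
    rw [hFeq]
    simp
  refine ⟨E, F, x, y, ⟨hx0, hx, fun γ => ?_, hyB, hB⟩⟩
  haveI := hfi
  refine ⟨_, Nat.pos_of_ne_zero Subgroup.index_ne_zero_of_finite, Subgroup.pow_index_mem _ γ⟩

end Existence

/-! ### Abhyankar bases along a finite extension of valued fields -/

section Extension

variable {K₁ : Type u} [Field K₁] [Algebra K K₁] [Algebra k K₁] [IsScalarTower k K K₁]
  (O₁ : ValuationSubring K₁)

/-- `k ⊆ K₁° ∩ K = K°`. [folklore] -/
theorem algebraMap_mem_comap_of_mem (hk₁ : ∀ c : k, algebraMap k K₁ c ∈ O₁) (c : k) :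
    algebraMap k K c ∈ O₁.comap (algebraMap K K₁) := by
  change algebraMap K K₁ (algebraMap k K c) ∈ O₁
  rw [← IsScalarTower.algebraMap_apply]
  exact hk₁ c

/-- A finite extension of a finitely generated field extension is finitely generated over the
bottom field. [folklore] -/
theorem intermediateField_fg_top_of_finite [FiniteDimensional K K₁]
    (hfg : (⊤ : IntermediateField k K).FG) : (⊤ : IntermediateField k K₁).FG := by
  haveI : Algebra.EssFiniteType k K := IntermediateField.fg_top_iff.mp hfg
  haveI : Algebra.EssFiniteType K K₁ := inferInstance
  exact IntermediateField.fg_top_iff.mpr (Algebra.EssFiniteType.comp k K K₁)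

/-- **`D = 0` is inherited by finite extensions of valued fields**, and then `E` and `F` do not
change either (Temkin 2013, §2.1: `E`, `F` grow in extensions and `tr.deg` does not change in an
algebraic one). [cite: Temkin2013, Section 2.1 (p. 10)] -/
theorem transcendenceDefect_eq_zero_of_finite [FiniteDimensional K K₁]
    (hk₁ : ∀ c : k, algebraMap k K₁ c ∈ O₁) (hfg : (⊤ : IntermediateField k K).FG)
    (hD : transcendenceDefect k (O₁.comap (algebraMap K K₁)) (algebraMap_mem_comap_of_mem O₁ hk₁) = 0) :
    transcendenceDefect k O₁ hk₁ = 0 ∧ ratRank O₁ = ratRank (O₁.comap (algebraMap K K₁)) ∧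
      residueTrdeg k O₁ hk₁ =
        residueTrdeg k (O₁.comap (algebraMap K K₁)) (algebraMap_mem_comap_of_mem O₁ hk₁) ∧
      Algebra.trdeg k K₁ = Algebra.trdeg k K := by
  set O := O₁.comap (algebraMap K K₁) with hO
  have hk : ∀ c : k, algebraMap k K c ∈ O := algebraMap_mem_comap_of_mem O₁ hk₁
  have hN : Algebra.trdeg k K < ℵ₀ := trdeg_lt_aleph0_of_fg hfg
  have htr : Algebra.trdeg k K₁ = Algebra.trdeg k K := by
    have h := trdeg_add_eq k K (A := K₁)
    rw [trdeg_eq_zero (R := K) (A := K₁), add_zero] at h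
    exact h.symm
  have hN₁ : Algebra.trdeg k K₁ < ℵ₀ := htr ▸ hN
  have hE : ratRank O ≤ ratRank O₁ := ratRank_comap_le O₁
  have hF : residueTrdeg k O hk ≤ residueTrdeg k O₁ hk₁ := residueTrdeg_comap_le k O₁ hk₁ hk
  have hsum := (transcendenceDefect_eq_zero_iff O hk hN).mp hD
  have hle₁ := ratRank_add_residueTrdeg_le_trdeg O₁ hk₁
  obtain ⟨hE', hF'⟩ := eq_and_eq_of_add_eq_of_le (a := ratRank O₁) (b := residueTrdeg k O₁ hk₁)
    (c := Algebra.trdeg k K₁) (s := ratRank O) (t := residueTrdeg k O hk)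
    (le_antisymm hle₁ (by rw [htr, ← hsum]; exact add_le_add hE hF)) hE hF (by rw [htr, hsum]) hN₁
  refine ⟨(transcendenceDefect_eq_zero_iff O₁ hk₁ hN₁).mpr ?_, hE', hF', htr⟩
  rw [hE', hF', htr, hsum]

/-- The `ℤ`-linear map of value groups `|K^×| → |K₁^×|` (additively written) along `K → K₁`.
[folklore] -/
theorem linearIndependent_valuation_algebraMap {ι : Type*} {x : ι → K} (hx0 : ∀ j, x j ≠ 0)
    (hx : LinearIndependent ℤ fun j => Additive.ofMul
      (Units.mk0 ((O₁.comap (algebraMap K K₁)).valuation (x j))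
        (valuation_ne_zero_of_ne_zero _ (hx0 j)))) :
    LinearIndependent ℤ fun j => Additive.ofMul
      (Units.mk0 (O₁.valuation (algebraMap K K₁ (x j)))
        (valuation_ne_zero_of_ne_zero O₁ ((map_ne_zero _).mpr (hx0 j)))) := by
  let ι' : Additive ((O₁.comap (algebraMap K K₁)).ValueGroup)ˣ →ₗ[ℤ] Additive (O₁.ValueGroup)ˣ :=
    (MonoidHom.toAdditive (unitsValueGroupHom K O₁)).toIntLinearMap
  have hker : LinearMap.ker ι' = ⊥ :=
    LinearMap.ker_eq_bot.mpr fun a b h => unitsValueGroupHom_injective K O₁ h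
  have heq : (fun j => Additive.ofMul (Units.mk0 (O₁.valuation (algebraMap K K₁ (x j)))
      (valuation_ne_zero_of_ne_zero O₁ ((map_ne_zero _).mpr (hx0 j))))) =
      ι' ∘ fun j => Additive.ofMul (Units.mk0 ((O₁.comap (algebraMap K K₁)).valuation (x j))
        (valuation_ne_zero_of_ne_zero _ (hx0 j))) := by
    funext j
    change Additive.ofMul _ = Additive.ofMul (unitsValueGroupHom K O₁
      (Units.mk0 ((O₁.comap (algebraMap K K₁)).valuation (x j))
        (valuation_ne_zero_of_ne_zero _ (hx0 j))))
    rw [unitsValueGroupHom_mk0]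
  rw [heq]
  exact hx.map' ι' hker

/-- **An Abhyankar basis of `K` is an Abhyankar basis of every finite extension `K₁/K` of valued
fields** (Temkin 2013, proof of Thm. 5.5.2, p. 61: "Notice that `B` is an Abhyankar basis of each
`Kᵢ`"). PROVED: the values stay `ℤ`-independent (`|K^×| → |K₁^×|` is injective) and of finite
index (`|K^×|` has finite index in `|K₁^×|`, `finiteIndex_of_forall_mk0_valuation_mem`), the
residues stay algebraically independent and, `F` being unchanged, a transcendence basis of `K̃₁`,
and `B` stays a transcendence basis as `K₁/K` is algebraic.
[cite: Temkin2013, proof of Thm. 5.5.2 (p. 61)] -/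
theorem IsAbhyankarBasis.extension [FiniteDimensional K K₁] (hk₁ : ∀ c : k, algebraMap k K₁ c ∈ O₁)
    (hfg : (⊤ : IntermediateField k K).FG)
    {E F : ℕ} {x : Fin E → K} {y : Fin F → O₁.comap (algebraMap K K₁)}
    (hB : IsAbhyankarBasis (O₁.comap (algebraMap K K₁)) (algebraMap_mem_comap_of_mem O₁ hk₁) x y)
    (hD : transcendenceDefect k (O₁.comap (algebraMap K K₁)) (algebraMap_mem_comap_of_mem O₁ hk₁) = 0) :
    IsAbhyankarBasis O₁ hk₁ (fun j => algebraMap K K₁ (x j)) fun i => comapInclusion O₁ (y i) := by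
  classical
  have hk : ∀ c : k, algebraMap k K c ∈ O₁.comap (algebraMap K K₁) :=
    algebraMap_mem_comap_of_mem O₁ hk₁
  obtain ⟨-, -, hF₁, -⟩ := transcendenceDefect_eq_zero_of_finite O₁ hk₁ hfg hD
  have hx0₁ : ∀ j, algebraMap K K₁ (x j) ≠ 0 := fun j => (map_ne_zero _).mpr (hB.ne_zero j)
  -- values: `ℤ`-independent
  have hli := linearIndependent_valuation_algebraMap O₁ hB.ne_zero hB.linearIndependent
  -- residues: algebraically independent, a transcendence basis of `K̃₁`
  letI i₁ : Algebra k O₁ := algebraOfMem k O₁ hk₁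
  letI i₀ : Algebra k (O₁.comap (algebraMap K K₁)) := algebraOfMem k (O₁.comap (algebraMap K K₁)) hk
  haveI := isScalarTower_algebraOfMem k O₁ hk₁
  haveI := isScalarTower_algebraOfMem k (O₁.comap (algebraMap K K₁)) hk
  let ψ : ResidueField (O₁.comap (algebraMap K K₁)) →ₐ[k] ResidueField O₁ :=
    residueFieldComapAlgHom k O₁ hk₁ hk
  have hψ : ∀ i, residue O₁ (comapInclusion O₁ (y i)) = ψ (residue _ (y i)) := fun i => by
    change _ = ResidueField.map (comapInclusion O₁) (residue _ (y i))
    rw [ResidueField.map_residue]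
  have hψ' : (fun i => residue O₁ (comapInclusion O₁ (y i))) = ψ ∘ fun i => residue _ (y i) :=
    funext hψ
  have h0 : AlgebraicIndependent k fun i => residue (O₁.comap (algebraMap K K₁)) (y i) :=
    hB.algebraicIndependent_residue
  have hyind : AlgebraicIndependent k fun i => residue O₁ (comapInclusion O₁ (y i)) := by
    rw [hψ']
    exact h0.map' ψ.toRingHom.injective
  have hyres : IsTranscendenceBasis k fun i => residue (O₁.comap (algebraMap K K₁)) (y i) :=
    hB.isTranscendenceBasis_residue
  have hyB : IsTranscendenceBasis k fun i => residue O₁ (comapInclusion O₁ (y i)) := by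
    refine hyind.isTranscendenceBasis_of_lift_trdeg_le_of_finite ?_
    -- `tr.deg k K̃₁ = F(K₁) = F(K) = F`
    have h1 : Algebra.trdeg k (ResidueField O₁) = residueTrdeg k O₁ hk₁ :=
      (residueTrdeg_eq (k := k) O₁ hk₁).symm
    have h2 : (F : Cardinal) = residueTrdeg k (O₁.comap (algebraMap K K₁)) hk := by
      have h := hyres.lift_cardinalMk_eq_trdeg
      simp only [Cardinal.mk_fintype, Fintype.card_fin, Cardinal.lift_natCast,
        Cardinal.lift_uzero] at h
      rw [residueTrdeg_eq (k := k) (O₁.comap (algebraMap K K₁)) hk]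
      exact_mod_cast h
    rw [h1, hF₁, ← h2]
    simp
  -- `B` is a transcendence basis of `K₁/k`
  have hB₁ : IsTranscendenceBasis k
      (Sum.elim (fun j => algebraMap K K₁ (x j)) fun i => (comapInclusion O₁ (y i) : K₁)) := by
    have heq : (Sum.elim (fun j => algebraMap K K₁ (x j)) fun i => (comapInclusion O₁ (y i) : K₁)) =
        algebraMap K K₁ ∘ Sum.elim x fun i => (y i : K) := by
      funext s; rcases s with j | i <;> rfl
    rw [heq]
    exact hB.isTranscendenceBasis.algebraMap_comp
  refine ⟨hx0₁, hli, fun γ => ?_, hyB, hB₁⟩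
  -- finite index: `|K^×|` has finite index in `|K₁^×|`, and `Λ_B` has finite index in `|K^×|`
  let φ : K →ₐ[k] K₁ := IsScalarTower.toAlgHom k K K₁
  let Fr : IntermediateField k K₁ := φ.fieldRange
  letI : Algebra K Fr := (AlgEquiv.ofInjectiveField φ).toAlgHom.toRingHom.toAlgebra
  haveI : IsScalarTower K Fr K₁ := IsScalarTower.of_algebraMap_eq fun _ => rfl
  haveI : FiniteDimensional Fr K₁ := Module.Finite.of_restrictScalars_finite K Fr K₁
  let H : Subgroup (O₁.ValueGroup)ˣ := (unitsValueGroupHom K O₁).range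
  have hHmem : ∀ c : K₁, c ∈ Fr → (hc : c ≠ 0) →
      Units.mk0 (O₁.valuation c) (valuation_ne_zero_of_ne_zero O₁ hc) ∈ H := by
    rintro _ ⟨a, rfl⟩ hc
    have ha : a ≠ 0 := fun h => hc (by rw [h]; exact map_zero φ)
    refine ⟨Units.mk0 ((O₁.comap (algebraMap K K₁)).valuation a)
      (valuation_ne_zero_of_ne_zero _ ha), ?_⟩
    rw [unitsValueGroupHom_mk0]
    rfl
  obtain ⟨hfi, -⟩ := finiteIndex_of_forall_mk0_valuation_mem O₁ Fr H hHmem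
  haveI := hfi
  have hγ : γ ^ H.index ∈ H := Subgroup.pow_index_mem H γ
  obtain ⟨δ, hδ⟩ := hγ
  obtain ⟨n, hn, hδn⟩ := hB.exists_pow_mem_closure δ
  refine ⟨H.index * n, Nat.mul_pos (Nat.pos_of_ne_zero Subgroup.index_ne_zero_of_finite) hn, ?_⟩
  rw [pow_mul, ← hδ, ← map_pow]
  -- the image of `Λ_B ⊆ |K^×|` is `Λ_B ⊆ |K₁^×|`
  have himage : (Subgroup.closure (Set.range fun j =>
      Units.mk0 ((O₁.comap (algebraMap K K₁)).valuation (x j))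
        (valuation_ne_zero_of_ne_zero _ (hB.ne_zero j)))).map (unitsValueGroupHom K O₁) =
      Subgroup.closure (Set.range fun j => Units.mk0 (O₁.valuation (algebraMap K K₁ (x j)))
        (valuation_ne_zero_of_ne_zero O₁ (hx0₁ j))) := by
    have hfun : ((unitsValueGroupHom K O₁) ∘ fun j =>
        Units.mk0 ((O₁.comap (algebraMap K K₁)).valuation (x j))
          (valuation_ne_zero_of_ne_zero _ (hB.ne_zero j))) =
        fun j => Units.mk0 (O₁.valuation (algebraMap K K₁ (x j)))
          (valuation_ne_zero_of_ne_zero O₁ (hx0₁ j)) := by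
      funext j
      simp only [Function.comp_apply, unitsValueGroupHom_mk0]
    rw [MonoidHom.map_closure, ← Set.range_comp, hfun]
  rw [← himage]
  exact Subgroup.mem_map_of_mem _ hδn

end Extension

/-! ### Adapted Abhyankar bases -/

section Adapted

variable (O : ValuationSubring K) (hk : ∀ c : k, algebraMap k K c ∈ O)

/-- **Adapted Abhyankar bases** (the hypothesis of Temkin 2013, Thm. 5.5.1 (iii), p. 59: "`B̃_F`
is a separable transcendence basis of `K̃` and `|B_E|` is a basis of `|K^×|`"; used in the proof
of Thm. 5.5.2, p. 60). For a finitely generated `K/k` with `D = 0` and any finite transcendence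
basis `s` of the residue field `K̃` over `k`, there is an Abhyankar transcendence basis
`B = x ⊔ y` whose values `|xⱼ|` form a `ℤ`-basis of the lattice `Λ = |K^×|` (Remark 2.1.3) and
whose `B_F = y` reduces onto `s`. PROVED. [cite: Temkin2013, Thm. 5.5.1 (iii) (p. 59) and proof of Thm. 5.5.2 (p. 60)] -/
theorem exists_adapted_isAbhyankarBasis (hfg : (⊤ : IntermediateField k K).FG)
    (hD : transcendenceDefect k O hk = 0)
    (s : Finset (letI := algebraOfMem k O hk; ResidueField O))
    (hs : letI := algebraOfMem k O hk
      IsTranscendenceBasis k ((↑) : s → ResidueField O)) :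
    ∃ (E : ℕ) (x : Fin E → K) (y : Fin s.card → O) (hB : IsAbhyankarBasis O hk x y),
      Subgroup.closure (Set.range fun j =>
        Units.mk0 (O.valuation (x j)) (valuation_ne_zero_of_ne_zero O (hB.ne_zero j))) = ⊤ ∧
      (letI := algebraOfMem k O hk
       Set.range (fun i => residue O (y i)) = (s : Set (ResidueField O))) := by
  classical
  letI := algebraOfMem k O hk
  haveI := isScalarTower_algebraOfMem k O hk
  obtain ⟨hfin, hfree, hrank⟩ := valueGroup_lattice_of_transcendenceDefect_eq_zero O hfg hk hD
  haveI := hfin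
  haveI := hfree
  -- `B_E`: lifts of a `ℤ`-basis of `Λ`
  set E := Module.finrank ℤ (Additive (ValueGroup O)ˣ) with hEdef
  let b : Module.Basis (Fin E) ℤ (Additive (ValueGroup O)ˣ) := Module.finBasis ℤ _
  choose x hx using fun j => O.valuation_surjective
    ((Additive.toMul (b j) : (ValueGroup O)ˣ) : ValueGroup O)
  have hx0 : ∀ j, x j ≠ 0 := fun j h => by
    have h1 := hx j
    rw [h, map_zero] at h1
    exact (Additive.toMul (b j)).ne_zero h1.symm
  have hxb : ∀ j, Units.mk0 (O.valuation (x j)) (valuation_ne_zero_of_ne_zero O (hx0 j)) =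
      Additive.toMul (b j) := fun j => Units.ext (hx j)
  have hxb' : (fun j => Additive.ofMul (Units.mk0 (O.valuation (x j))
      (valuation_ne_zero_of_ne_zero O (hx0 j)))) = b := by
    funext j; rw [hxb]; rfl
  have hxli : LinearIndependent ℤ fun j => Additive.ofMul (Units.mk0 (O.valuation (x j))
      (valuation_ne_zero_of_ne_zero O (hx0 j))) := by
    rw [hxb']; exact b.linearIndependent
  have hxtop : Subgroup.closure (Set.range fun j =>
      Units.mk0 (O.valuation (x j)) (valuation_ne_zero_of_ne_zero O (hx0 j))) = ⊤ := by
    have : (fun j => Units.mk0 (O.valuation (x j)) (valuation_ne_zero_of_ne_zero O (hx0 j))) =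
        fun j => Additive.toMul (b j) := funext hxb
    rw [this]
    exact subgroup_closure_range_basis b
  -- `B_F`: lifts of `s`
  let e : Fin s.card ≃ s := s.equivFin.symm
  choose y hy using fun i => IsLocalRing.residue_surjective (R := O) ((e i : s) : ResidueField O)
  have hyrange : Set.range (fun i => residue O (y i)) = (s : Set (ResidueField O)) := by
    ext z
    constructor
    · rintro ⟨i, rfl⟩
      change residue O (y i) ∈ (s : Set (ResidueField O))
      rw [hy]; exact (e i).2
    · intro hz
      refine ⟨e.symm ⟨z, hz⟩, ?_⟩
      change residue O (y _) = z
      rw [hy, Equiv.apply_symm_apply]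
  have hyB : IsTranscendenceBasis k fun i => residue O (y i) := by
    have heq : (fun i => residue O (y i)) = ((↑) : s → ResidueField O) ∘ e := by
      funext i; exact hy i
    rw [heq]
    exact hs.comp_equiv e
  -- `B` is a transcendence basis: algebraically independent of cardinality `E + F = N`
  have hind : AlgebraicIndependent k (Sum.elim x fun i => (y i : K)) :=
    algebraicIndependent_sumElim_of_valuation O y hyB.1 x (injective_valuation_prod_pow O x hx0 hxli)
  obtain ⟨E', F', hE', hF', hNEF⟩ := exists_ratRank_eq_residueTrdeg_eq O hk hfg hD
  have hEE : E = E' := by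
    have h : (E : Cardinal) = E' := by rw [hEdef, hrank, hE']
    exact_mod_cast h
  have hFF : s.card = F' := by
    have h := hs.lift_cardinalMk_eq_trdeg
    simp only [Cardinal.mk_fintype, Fintype.card_coe, Cardinal.lift_id] at h
    have h' : (s.card : Cardinal) = F' := by
      rw [h, ← residueTrdeg_eq (k := k) O hk, hF']
    exact_mod_cast h'
  have hB : IsTranscendenceBasis k (Sum.elim x fun i => (y i : K)) := by
    refine hind.isTranscendenceBasis_of_lift_trdeg_le_of_finite ?_
    rw [hNEF]
    simp only [Cardinal.mk_sum, Cardinal.mk_fin, Cardinal.lift_natCast, Cardinal.lift_add]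
    rw [hEE, hFF]
    exact (Nat.cast_add E' F').le
  refine ⟨E, x, y, ⟨hx0, hxli, fun γ => ⟨1, Nat.one_pos, ?_⟩, hyB, hB⟩, hxtop, hyrange⟩
  rw [pow_one, hxtop]; trivial

end Adapted

end Literature.AlgebraicGeometry.Resolution

end
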